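/-
Copyright (c) 2026. All rights reserved.
Released under Apache 2.0 license as described in the file LICENSE.
Authors: abc-iut cell, campaign-S prover seat abc-iut-S1 (wave 1, gen 7).
-/
import Literature.IUT.LogVolume.UnitLogWildDyadicQuarticGaussian
import HarnessLib

/-!
# A dyadic `(e, f) = (8, 1)` field containing `√−1` in which the `2`-adic logarithm of a unit IS a unit

Proof-only sequel (theorems, no definitions) of `UnitLogWildDyadicQuarticGaussian.lean` (abc-iut-S1:
`(e, f) = (4, 1)` and `√−1 ∈ K` ⇒ `log₂(𝒪_K^×)` MISSES `𝒪_K^×`).  That emptiness does NOT persist to the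
next class relevant to fields containing `√−1` ([IUTchI] Def. 3.1): at `(e, f) = (8, 1)` there are fields
`K ∋ √−1` whose unit logarithms MEET `𝒪_K^×`.

* `norm_unitLog_eq_one_of_pow_eight_eq_neg` — in every `K/ℚ₂`: **`α⁸ = −25 ⇒ ‖log₂ α‖ = 1`** (witness
  lemma of `UnitLogWildDyadicQuarticPair` with `ζ = α¹²/125`, a fourth root of unity, and
  `ζ·α⁴ = α¹⁶/125 = 5`, `‖5 − 1‖ = ‖4‖`); such a `K` contains `√−1 = α⁴/5`
  (`exists_sq_eq_neg_one_of_pow_eight_eq_neg`).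
* `exists_octic_gaussian_logUnits_inter_sphere_nonempty` — **`E = ℚ₂(⁸√−25) = ℚ₂(√−1, ⁴√(5√−1)) ⊆ ℚ̄₂`
  has `(e, f) = (8, 1)`, contains `√−1`, and `log₂(𝒪_E^×) ∩ 𝒪_E^× ≠ ∅`**; `e = 8` because
  `(β − 1)⁸ = (70β⁴ − 24) + 4·(−2β⁷ + 7β⁶ − 14β⁵ − 14β³ + 7β² − 2β)` has norm `‖2‖`
  (`absRamificationIdx_eq_of_norm_pow`, the degree-`n` form of the parent files' `e = 4` lemma).

So for the fields of [IUTchI] Def. 3.1 the dyadic census at `f = 1` reads: `e ≡ 2 (mod 4)` ⇒ empty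
(abc-iut-w5-d017), `e = 4` ⇒ empty (parent file), `e = 8` ⇒ NOT always empty (this file).  Classical
(Neukirch II (5.5), Koblitz IV §1–2); consumer: the cell's (Ind3) honest-model census ([IUTchIII]
Rmk. 1.1.1 (i), record only).  Nothing here is disputed mathematics; no IUT statement is asserted; nothing
bears on [IUTchIII] Cor. 3.12.
-/

noncomputable section

open Metric Set

namespace Literature.IUT.LogVolume

namespace WildDyadicQuartic

open Literature.NumberTheory.GaloisRepresentations.Ultrametric RamificationCriterion

variable {K : Type*} [NontriviallyNormedField K] [instK : NormedAlgebra ℚ_[2] K] [IsUltrametricDist K]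
  [ProperSpace K]

omit [IsUltrametricDist K] [ProperSpace K] in
/-- Natural numbers have norm `≤ 1` in a normed `ℚ₂`-algebra. [cite: NeukirchANT1999, Ch. II (5.5)] -/
private theorem norm_natCast_le_one' (n : ℕ) : ‖(n : K)‖ ≤ 1 := by
  rw [norm_natCast_eq_padicNorm 2 K n]
  exact_mod_cast Padic.norm_int_le_one (n : ℤ)

omit [IsUltrametricDist K] [ProperSpace K] in
/-- Odd natural numbers have norm `1`. [cite: NeukirchANT1999, Ch. II (5.5)] -/
private theorem norm_natCast_odd {n : ℕ} (hn : n % 2 = 1) : ‖(n : K)‖ = 1 :=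
  norm_natCast_eq_one_of_not_dvd 2 (by omega)

/-! ### §1. `α⁸ = −25 ⇒ ‖log₂ α‖ = 1`, and `√−1 = α⁴/5` -/

omit [IsUltrametricDist K] [ProperSpace K] in
/-- `α⁸ = −25 ⇒ (α⁴/5)² = −1`: such a field contains `√−1`. [cite: NeukirchANT1999, Ch. II (5.5)] -/
theorem exists_sq_eq_neg_one_of_pow_eight_eq_neg {α : K} (hα : α ^ 8 = -25) : ∃ i : K, i ^ 2 = -1 := by
  have h5 : (5 : K) ≠ 0 := norm_pos_iff.mp (by
    rw [show (5 : K) = ((5 : ℕ) : K) by norm_cast, norm_natCast_odd (by norm_num)]; norm_num)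
  refine ⟨α ^ 4 / 5, ?_⟩
  rw [div_pow, ← pow_mul, show 4 * 2 = 8 by rfl, hα]
  field_simp
  norm_num

/-- **`α⁸ = −25 ⇒ ‖log₂ α‖ = 1`** (in every `K/ℚ₂` containing such an `α`): `ζ = α¹²/125` has `ζ⁴ = 1` and
`ζ·α⁴ − 1 = α¹⁶/125 − 1 = 4`, so the witness lemma applies. [cite: Koblitz1984, Ch. IV §2] -/
theorem norm_unitLog_eq_one_of_pow_eight_eq_neg {α : K} (hα : α ^ 8 = -25) : ‖unitLog α‖ = 1 := by
  have h25 : ‖(25 : K)‖ = 1 := by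
    rw [show (25 : K) = ((25 : ℕ) : K) by norm_cast]; exact norm_natCast_odd (by norm_num)
  have h125 : (125 : K) ≠ 0 := norm_pos_iff.mp (by
    rw [show (125 : K) = ((125 : ℕ) : K) by norm_cast, norm_natCast_odd (by norm_num)]; norm_num)
  have hα1 : ‖α‖ = 1 := by
    have h1 : ‖α‖ ^ 8 = 1 := by rw [← norm_pow, hα, norm_neg, h25]
    exact (pow_eq_one_iff_of_nonneg (norm_nonneg α) (by norm_num)).mp h1
  have h16 : α ^ 16 = 625 := by
    rw [show (16 : ℕ) = 8 * 2 by rfl, pow_mul, hα]; norm_num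
  have h48 : α ^ 48 = 25 ^ 6 := by
    rw [show (48 : ℕ) = 8 * 6 by rfl, pow_mul, hα]; norm_num
  have hζ4 : (α ^ 12 / 125) ^ 4 = 1 := by
    rw [div_pow, ← pow_mul, show 12 * 4 = 48 by rfl, h48]
    field_simp
    norm_num
  refine norm_unitLog_eq_one_of_norm_torsion_mul_pow_four_sub_one hα1 (n := 4) (by norm_num) hζ4 ?_
  rw [div_mul_eq_mul_div, ← pow_add, show 12 + 4 = 16 by rfl, h16,
    show (625 : K) / 125 - 1 = 4 by field_simp; norm_num]

/-- … so `log₂(𝒪_K^×)` MEETS the unit sphere whenever `K ∋ ⁸√−25`. [cite: Koblitz1984, Ch. IV §2] -/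
theorem logUnits_inter_sphere_nonempty_of_pow_eight_eq_neg {α : K} (hα : α ^ 8 = -25) :
    (logUnits K ∩ sphere 0 1).Nonempty := by
  have h25 : ‖(25 : K)‖ = 1 := by
    rw [show (25 : K) = ((25 : ℕ) : K) by norm_cast]; exact norm_natCast_odd (by norm_num)
  have hα1 : ‖α‖ = 1 := by
    have h1 : ‖α‖ ^ 8 = 1 := by rw [← norm_pow, hα, norm_neg, h25]
    exact (pow_eq_one_iff_of_nonneg (norm_nonneg α) (by norm_num)).mp h1
  exact ⟨unitLog α, unitLog_mem_logUnits hα1,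
    mem_sphere_zero_iff_norm.mpr (norm_unitLog_eq_one_of_pow_eight_eq_neg hα)⟩

/-! ### §2. `ℚ₂(⁸√−25) ⊆ ℚ̄₂`: `(e, f) = (8, 1)`, `∋ √−1`, inhabited -/

section AlgCl

open Polynomial IntermediateField

/-- A finite `E ⊆ ℚ̄₂` of degree `≤ n` over `ℚ₂` (`n ≥ 1`) containing an `x` with `‖x‖ⁿ = 1/2` has `e = n`
and `f = 1` (`‖x‖ ≤ 2^{−1/e}` forces `e ≥ n`; `e·f ≤ n`). [cite: NeukirchANT1999, Ch. II (5.5)] -/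
theorem absRamificationIdx_eq_of_norm_pow (E : IntermediateField ℚ_[2] (PadicAlgCl 2))
    [FiniteDimensional ℚ_[2] E] {n : ℕ} (hn : 0 < n) (hdeg : Module.finrank ℚ_[2] E ≤ n) {x : E}
    (hx : ‖x‖ ^ n = 2⁻¹) : absRamificationIdx 2 E = n ∧ residueDegree 2 E = 1 := by
  have hef := absRamificationIdx_mul_residueDegree 2 (E : Type _)
  have hf := residueDegree_pos 2 (E : Type _)
  have hxlt : ‖x‖ < 1 :=
    (pow_lt_one_iff_of_nonneg (norm_nonneg _) hn.ne').mp (by rw [hx]; norm_num)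
  have hdisc := norm_le_rpow_of_norm_lt_one 2 (E : Type _) hxlt
  set e := absRamificationIdx 2 E with hedef
  have he0 : (0 : ℝ) < e := by exact_mod_cast absRamificationIdx_pos 2 (E : Type _)
  have h4 : ‖x‖ ^ n ≤ ((2 : ℝ) ^ (-(1 / (e : ℝ)))) ^ n := pow_le_pow_left₀ (norm_nonneg _) hdisc n
  rw [hx, ← Real.rpow_natCast, ← Real.rpow_mul (by norm_num), ← Real.rpow_neg_one,
    Real.rpow_le_rpow_left_iff (by norm_num : (1 : ℝ) < 2)] at h4
  have hege : (n : ℝ) ≤ e := by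
    have h := mul_le_mul_of_nonneg_right h4 he0.le
    field_simp at h
    linarith
  have hege' : n ≤ e := by exact_mod_cast hege
  have hprod : e * residueDegree 2 E ≤ n := hef.trans_le hdeg
  have hf1 : residueDegree 2 E = 1 := by nlinarith
  refine ⟨?_, hf1⟩
  rw [hf1, mul_one] at hprod
  exact le_antisymm hprod hege'

/-- **`ℚ₂(⁸√−25) = ℚ₂(√−1, ⁴√(5√−1)) ⊆ ℚ̄₂` has `(e, f) = (8, 1)`, contains `√−1`, and `log₂(𝒪^×)` MEETS the
unit sphere** (`β⁸ = −25`; degree `≤ 8`; `‖(β − 1)⁸‖ = ‖(70β⁴ − 24) + 4(…)‖ = ‖2‖` forces `e = 8`).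
[cite: Koblitz1984, Ch. IV §2] -/
theorem exists_octic_gaussian_logUnits_inter_sphere_nonempty :
    ∃ (E : IntermediateField ℚ_[2] (PadicAlgCl 2)) (_ : FiniteDimensional ℚ_[2] E),
      absRamificationIdx 2 E = 8 ∧ residueDegree 2 E = 1 ∧ (∃ i : E, i ^ 2 = -1) ∧
        (logUnits E ∩ sphere 0 1).Nonempty := by
  obtain ⟨β, hβ⟩ := IsAlgClosed.exists_pow_nat_eq (-25 : PadicAlgCl 2) (by norm_num : 0 < 8)
  have heval : Polynomial.aeval β (X ^ 8 + C (25 : ℚ_[2])) = 0 := by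
    simp [hβ, map_ofNat]
  have hint : IsIntegral ℚ_[2] β := ⟨X ^ 8 + C 25, monic_X_pow_add_C 25 (by norm_num), by
    simpa [Polynomial.aeval_def] using heval⟩
  haveI hfd : FiniteDimensional ℚ_[2] ℚ_[2]⟮β⟯ := adjoin.finiteDimensional hint
  have hα : (⟨β, mem_adjoin_simple_self ℚ_[2] β⟩ : ℚ_[2]⟮β⟯) ^ 8 = -25 := by
    apply Subtype.ext
    have h25E : ((25 : ℚ_[2]⟮β⟯) : PadicAlgCl 2) = 25 := map_ofNat (algebraMap ℚ_[2]⟮β⟯ (PadicAlgCl 2)) 25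
    have hmE : ((-25 : ℚ_[2]⟮β⟯) : PadicAlgCl 2) = -25 := by
      rw [show (-25 : ℚ_[2]⟮β⟯) = -(25 : ℚ_[2]⟮β⟯) by rfl, ← h25E]
      simp
    simp [hβ, hmE]
  set α : ℚ_[2]⟮β⟯ := ⟨β, mem_adjoin_simple_self ℚ_[2] β⟩ with hαdef
  have hdeg : Module.finrank ℚ_[2] ℚ_[2]⟮β⟯ ≤ 8 := by
    rw [adjoin.finrank hint]
    have hdvd : minpoly ℚ_[2] β ∣ X ^ 8 + C 25 := minpoly.dvd ℚ_[2] β heval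
    have hne : (X ^ 8 + C (25 : ℚ_[2])) ≠ 0 := (monic_X_pow_add_C 25 (by norm_num)).ne_zero
    calc (minpoly ℚ_[2] β).natDegree ≤ (X ^ 8 + C (25 : ℚ_[2])).natDegree := natDegree_le_of_dvd hdvd hne
      _ = 8 := natDegree_X_pow_add_C
  -- `‖α‖ = 1` and `‖(α − 1)⁸‖ = 1/2`
  have h25 : ‖(25 : ℚ_[2]⟮β⟯)‖ = 1 := by
    rw [show (25 : ℚ_[2]⟮β⟯) = ((25 : ℕ) : ℚ_[2]⟮β⟯) by norm_cast]; exact norm_natCast_odd (by norm_num)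
  have hα1 : ‖α‖ = 1 := by
    have h1 : ‖α‖ ^ 8 = 1 := by rw [← norm_pow, hα, norm_neg, h25]
    exact (pow_eq_one_iff_of_nonneg (norm_nonneg α) (by norm_num)).mp h1
  have hid : (α - 1) ^ 8 = (70 * α ^ 4 - 24)
      + 4 * (-2 * α ^ 7 + 7 * α ^ 6 + -14 * α ^ 5 + -14 * α ^ 3 + 7 * α ^ 2 + -2 * α) := by
    have hexp : (α - 1) ^ 8 = α ^ 8 - 8 * α ^ 7 + 28 * α ^ 6 - 56 * α ^ 5 + 70 * α ^ 4 - 56 * α ^ 3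
        + 28 * α ^ 2 - 8 * α + 1 := by ring
    rw [hexp, hα]
    ring
  have hmain : ‖(70 : ℚ_[2]⟮β⟯) * α ^ 4 - 24‖ = 2⁻¹ := by
    rw [show (70 : ℚ_[2]⟮β⟯) * α ^ 4 - 24 = 2 * (35 * α ^ 4 + -12) by ring, norm_mul, WildDyadic.norm_two]
    have h35 : ‖(35 : ℚ_[2]⟮β⟯) * α ^ 4‖ = 1 := by
      rw [norm_mul, norm_pow, hα1, one_pow, mul_one,
        show (35 : ℚ_[2]⟮β⟯) = ((35 : ℕ) : ℚ_[2]⟮β⟯) by norm_cast]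
      exact norm_natCast_odd (by norm_num)
    have h12 : ‖(-12 : ℚ_[2]⟮β⟯)‖ < 1 := by
      rw [norm_neg, show (12 : ℚ_[2]⟮β⟯) = 4 * 3 by norm_num, norm_mul, UnramifiedDyadic.norm_four,
        show (3 : ℚ_[2]⟮β⟯) = ((3 : ℕ) : ℚ_[2]⟮β⟯) by norm_cast, norm_natCast_odd (by norm_num)]
      norm_num
    have hne : ‖(35 : ℚ_[2]⟮β⟯) * α ^ 4‖ ≠ ‖(-12 : ℚ_[2]⟮β⟯)‖ := by rw [h35]; exact (ne_of_lt h12).symm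
    rw [IsUltrametricDist.norm_add_eq_max_of_norm_ne_norm hne, h35, max_eq_left (h35 ▸ h12.le)]
    norm_num
  have hmono : ∀ (c k : ℕ), ‖(c : ℚ_[2]⟮β⟯) * α ^ k‖ ≤ 1 := fun c k ↦ by
    rw [norm_mul, norm_pow, hα1, one_pow, mul_one]; exact norm_natCast_le_one' c
  have hmono' : ∀ (c k : ℕ), ‖-(c : ℚ_[2]⟮β⟯) * α ^ k‖ ≤ 1 := fun c k ↦ by
    rw [neg_mul, norm_neg]; exact hmono c k
  have hult : ∀ a b : ℚ_[2]⟮β⟯, ‖a‖ ≤ 1 → ‖b‖ ≤ 1 → ‖a + b‖ ≤ 1 := fun a b ha hb ↦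
    (IsUltrametricDist.norm_add_le_max a b).trans (max_le ha hb)
  have hpoly : ‖(-2 : ℚ_[2]⟮β⟯) * α ^ 7 + 7 * α ^ 6 + -14 * α ^ 5 + -14 * α ^ 3 + 7 * α ^ 2 + -2 * α‖
      ≤ 1 := by
    refine hult _ _ (hult _ _ (hult _ _ (hult _ _ (hult _ _ ?_ ?_) ?_) ?_) ?_) ?_
    · exact_mod_cast hmono' 2 7
    · exact_mod_cast hmono 7 6
    · exact_mod_cast hmono' 14 5
    · exact_mod_cast hmono' 14 3
    · exact_mod_cast hmono 7 2
    · have := hmono' 2 1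
      rw [pow_one] at this
      exact_mod_cast this
  have htail : ‖(4 : ℚ_[2]⟮β⟯) * (-2 * α ^ 7 + 7 * α ^ 6 + -14 * α ^ 5 + -14 * α ^ 3 + 7 * α ^ 2 + -2 * α)‖
      ≤ 4⁻¹ := by
    rw [norm_mul, UnramifiedDyadic.norm_four]
    calc (4⁻¹ : ℝ) * _ ≤ 4⁻¹ * 1 := by gcongr
      _ = 4⁻¹ := mul_one _
  have hnorm : ‖α - 1‖ ^ 8 = 2⁻¹ := by
    rw [← norm_pow, hid]
    have hlt : ‖(4 : ℚ_[2]⟮β⟯) * (-2 * α ^ 7 + 7 * α ^ 6 + -14 * α ^ 5 + -14 * α ^ 3 + 7 * α ^ 2 + -2 * α)‖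
        < ‖(70 : ℚ_[2]⟮β⟯) * α ^ 4 - 24‖ := by
      rw [hmain]; exact htail.trans_lt (by norm_num)
    rw [IsUltrametricDist.norm_add_eq_max_of_norm_ne_norm (ne_of_gt hlt), max_eq_left hlt.le, hmain]
  obtain ⟨he, hf⟩ := absRamificationIdx_eq_of_norm_pow ℚ_[2]⟮β⟯ (by norm_num) hdeg hnorm
  exact ⟨ℚ_[2]⟮β⟯, hfd, he, hf, exists_sq_eq_neg_one_of_pow_eight_eq_neg hα,
    logUnits_inter_sphere_nonempty_of_pow_eight_eq_neg hα⟩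

end AlgCl

end WildDyadicQuartic

end Literature.IUT.LogVolume

end
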